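import Mathlib
import Summits.Ventures.PercRepro.RankLevelSetTriangleStar
import Summits.Ventures.PercRepro.TriangleCapMatroidReduction
import Summits.Ventures.PercRepro.TriangleCapDeltaForm

/-!
# PercRepro — the Δ-form hypothesis is only needed on triangle-inseparable matroids (p3, gen 26)

The induction of `TriangleCapDeltaForm` asks for a Δ-cocircuit in EVERY finite `Core3` matroid with a
triangle.  When the triangle hypergraph splits — the ground set is a disjoint union `A ⊔ B` with a triangle
in each part and every triangle inside one part — no cocircuit is needed: `T(M) = T(M ↾ A) + T(M ↾ B)`,
nullity is superadditive over the partition (`r(A ∪ B) ≤ r(A) + r(B)`), and the table is superadditive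
(`KK.P_superadd`, (L1)).  So the closed form `T(M) ≤ P_KK ν` follows from the Δ-form existence on
**triangle-inseparable** matroids alone — the weakest hypothesis of the lane so far.

* `HasTriangleSplit M` — a partition `A ⊔ B = E` with a triangle in each part and every triangle inside a part;
* `ExistsDeltaCocircuitInsep α` — the Δ-form existence restricted to matroids without a triangle split;
* `existsDeltaCocircuitInsep_of_existsDeltaCocircuit` — it is implied by `ExistsDeltaCocircuit α`;
* `ncard_triangles_eq_add_of_split` — `T(M) = T(M ↾ A) + T(M ↾ B)` under a split;
* `nullity_add_le_of_union` — `ν(A) + ν(B) ≤ ν(E)` for a partition `A ⊔ B = E`;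
* **`ncard_triangles_le_P_of_existsDeltaCocircuitInsep`** — `ExistsDeltaCocircuitInsep α → T(M) ≤ P_KK ν`.
The closed-form theorem is CONDITIONAL on its named hypothesis by construction. Axioms: standard.
-/

open scoped Matroid

namespace PercRepro

namespace TriangleCap

namespace Cocirc

open Set

variable {α : Type}

/-- A **triangle split** of `M`: a partition `A ⊔ B` of the ground set with a triangle inside each part and
every triangle inside one of the parts. -/
def HasTriangleSplit (M : Matroid α) : Prop :=
  ∃ A B : Set α, A ∪ B = M.E ∧ Disjoint A B ∧ (∃ C ∈ ThmN.triangles M, C ⊆ A) ∧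
    (∃ C ∈ ThmN.triangles M, C ⊆ B) ∧ ∀ C ∈ ThmN.triangles M, C ⊆ A ∨ C ⊆ B

/-- The Δ-form existence hypothesis on **triangle-inseparable** matroids only: every finite matroid of the class
with a triangle and without a triangle split has a cocircuit `K` with `gain M K ≤ P ν − P (ν − (|K| − 1))`. -/
def ExistsDeltaCocircuitInsep (α : Type) : Prop :=
  ∀ (M : Matroid α) [M.Finite], Core3 M → (ThmN.triangles M).Nonempty → ¬ HasTriangleSplit M →
    ∀ ν : ℕ, M.E.encard = M.eRank + ν →
      ∃ K : Set α, M.IsCocircuit K ∧ gain M K ≤ KK.P ν - KK.P (ν - (K.ncard - 1))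

/-- The unrestricted Δ-form existence implies the inseparable one. -/
theorem existsDeltaCocircuitInsep_of_existsDeltaCocircuit (h : ExistsDeltaCocircuit α) :
    ExistsDeltaCocircuitInsep α :=
  fun M _ hM hT _ ν hν => h M hM hT ν hν

/-- Under a triangle split, `T(M) = T(M ↾ A) + T(M ↾ B)`. -/
theorem ncard_triangles_eq_add_of_split (M : Matroid α) [M.Finite] {A B : Set α}
    (hAB : A ∪ B = M.E) (hdisj : Disjoint A B)
    (hsplit : ∀ C ∈ ThmN.triangles M, C ⊆ A ∨ C ⊆ B) :
    (ThmN.triangles M).ncard = (ThmN.triangles (M ↾ A)).ncard + (ThmN.triangles (M ↾ B)).ncard := by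
  have hA : A ⊆ M.E := hAB ▸ subset_union_left
  have hB : B ⊆ M.E := hAB ▸ subset_union_right
  rw [triangles_restrict M hA, triangles_restrict M hB]
  have hTfin : (ThmN.triangles M).Finite :=
    M.ground_finite.finite_subsets.subset (fun C hC => hC.1.subset_ground)
  have hunion : ThmN.triangles M =
      {C ∈ ThmN.triangles M | C ⊆ A} ∪ {C ∈ ThmN.triangles M | C ⊆ B} := by
    ext C
    constructor
    · intro hC
      rcases hsplit C hC with h | h
      · exact Or.inl ⟨hC, h⟩
      · exact Or.inr ⟨hC, h⟩
    · rintro (⟨hC, -⟩ | ⟨hC, -⟩) <;> exact hC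
  have hdis : Disjoint {C ∈ ThmN.triangles M | C ⊆ A} {C ∈ ThmN.triangles M | C ⊆ B} := by
    rw [Set.disjoint_left]
    rintro C ⟨hC, hCA⟩ ⟨-, hCB⟩
    obtain ⟨x, hx⟩ := hC.1.nonempty
    exact (Set.disjoint_left.1 hdisj) (hCA hx) (hCB hx)
  have hfinA : {C ∈ ThmN.triangles M | C ⊆ A}.Finite := hTfin.subset (fun C hC => hC.1)
  have hfinB : {C ∈ ThmN.triangles M | C ⊆ B}.Finite := hTfin.subset (fun C hC => hC.1)
  calc (ThmN.triangles M).ncard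
      = ({C ∈ ThmN.triangles M | C ⊆ A} ∪ {C ∈ ThmN.triangles M | C ⊆ B}).ncard := by rw [← hunion]
    _ = {C ∈ ThmN.triangles M | C ⊆ A}.ncard + {C ∈ ThmN.triangles M | C ⊆ B}.ncard :=
        ncard_union_eq hdis hfinA hfinB

/-- Nullity is superadditive over a partition of the ground set: with `|A| = r(A) + νA`, `|B| = r(B) + νB`,
`A ⊔ B = E` and `|E| = r(E) + ν`, one has `νA + νB ≤ ν` (submodularity `r(A ∪ B) ≤ r(A) + r(B)`). -/
theorem nullity_add_le_of_union (M : Matroid α) [M.Finite] {A B : Set α} (hAB : A ∪ B = M.E)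
    (hdisj : Disjoint A B) {rA rB r νA νB ν : ℕ} (hrA : M.eRk A = rA) (hrB : M.eRk B = rB)
    (hr : M.eRank = r) (hA : A.ncard = rA + νA) (hB : B.ncard = rB + νB) (hE : M.E.ncard = r + ν) :
    νA + νB ≤ ν := by
  have hsub : M.eRk (A ∪ B) ≤ M.eRk A + M.eRk B := M.eRk_union_le_eRk_add_eRk A B
  rw [hAB, M.eRk_ground, hr, hrA, hrB] at hsub
  have hsub' : r ≤ rA + rB := by exact_mod_cast hsub
  have hfinA : A.Finite := M.ground_finite.subset (hAB ▸ subset_union_left)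
  have hfinB : B.Finite := M.ground_finite.subset (hAB ▸ subset_union_right)
  have hcard : M.E.ncard = A.ncard + B.ncard := by
    rw [← hAB, ncard_union_eq hdisj hfinA hfinB]
  omega

/-- **The reduction to inseparable matroids.** If every finite triangle-inseparable matroid of the class with a
triangle has a cocircuit `K` with `gain M K ≤ P ν − P (ν − (|K| − 1))`, then every finite matroid of the class
with `|E| = r(E) + ν` has at most `P_KK ν` triangles: split matroids are handled by `T(M) = T(A) + T(B)`,
`ν(A) + ν(B) ≤ ν` and the superadditivity (L1) of the table. -/
theorem ncard_triangles_le_P_of_existsDeltaCocircuitInsep (hGB : ExistsDeltaCocircuitInsep α)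
    (M : Matroid α) [M.Finite] (hM : Core3 M) {ν : ℕ} (hν : M.E.encard = M.eRank + ν) :
    (ThmN.triangles M).ncard ≤ KK.P ν := by
  suffices H : ∀ n : ℕ, ∀ (M : Matroid α) [M.Finite], M.E.ncard = n → Core3 M →
      ∀ ν : ℕ, M.E.encard = M.eRank + ν → (ThmN.triangles M).ncard ≤ KK.P ν from
    H _ M rfl hM ν hν
  intro n
  induction n using Nat.strong_induction_on with
  | _ n ih =>
  intro M _ hn hM ν hν
  by_cases hT : (ThmN.triangles M).Nonempty
  swap
  · rw [Set.not_nonempty_iff_eq_empty] at hT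
    rw [hT, ncard_empty]
    exact Nat.zero_le _
  have hEfin := M.ground_finite
  have hRne : M.eRank ≠ ⊤ := ((M.eRank_le_encard_ground).trans_lt hEfin.encard_lt_top).ne
  obtain ⟨r, hr⟩ := ENat.ne_top_iff_exists.1 hRne
  by_cases hsp : HasTriangleSplit M
  · obtain ⟨A, B, hAB, hdisj, ⟨CA, hCA, hCAA⟩, ⟨CB, hCB, hCBB⟩, hsplit⟩ := hsp
    have hA : A ⊆ M.E := hAB ▸ subset_union_left
    have hB : B ⊆ M.E := hAB ▸ subset_union_right
    have hAfin : A.Finite := hEfin.subset hA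
    have hBfin : B.Finite := hEfin.subset hB
    haveI : (M ↾ A).Finite := Matroid.restrict_finite hAfin
    haveI : (M ↾ B).Finite := Matroid.restrict_finite hBfin
    have hrAne : M.eRk A ≠ ⊤ := ((M.eRk_le_encard _).trans_lt hAfin.encard_lt_top).ne
    obtain ⟨rA, hrA⟩ := ENat.ne_top_iff_exists.1 hrAne
    have hrBne : M.eRk B ≠ ⊤ := ((M.eRk_le_encard _).trans_lt hBfin.encard_lt_top).ne
    obtain ⟨rB, hrB⟩ := ENat.ne_top_iff_exists.1 hrBne
    have hrAle : M.eRk A ≤ A.encard := M.eRk_le_encard _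
    rw [← hrA, ← hAfin.cast_ncard_eq] at hrAle
    have hrAle' : rA ≤ A.ncard := by exact_mod_cast hrAle
    have hrBle : M.eRk B ≤ B.encard := M.eRk_le_encard _
    rw [← hrB, ← hBfin.cast_ncard_eq] at hrBle
    have hrBle' : rB ≤ B.ncard := by exact_mod_cast hrBle
    obtain ⟨νA, hνA⟩ : ∃ νA : ℕ, A.ncard = rA + νA := ⟨A.ncard - rA, by omega⟩
    obtain ⟨νB, hνB⟩ : ∃ νB : ℕ, B.ncard = rB + νB := ⟨B.ncard - rB, by omega⟩
    have hνA' : (M ↾ A).E.encard = (M ↾ A).eRank + (νA : ℕ∞) := by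
      rw [Matroid.restrict_ground_eq, Matroid.eRank_restrict, ← hrA, ← hAfin.cast_ncard_eq, hνA]
      push_cast
      rfl
    have hνB' : (M ↾ B).E.encard = (M ↾ B).eRank + (νB : ℕ∞) := by
      rw [Matroid.restrict_ground_eq, Matroid.eRank_restrict, ← hrB, ← hBfin.cast_ncard_eq, hνB]
      push_cast
      rfl
    have hAne : A.Nonempty := hCA.1.nonempty.mono hCAA
    have hBne : B.Nonempty := hCB.1.nonempty.mono hCBB
    have hAss : A ⊂ M.E := by
      refine hA.ssubset_of_ne ?_
      intro hAE
      obtain ⟨x, hxB⟩ := hBne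
      have hxA : x ∈ A := hAE ▸ hB hxB
      exact (Set.disjoint_left.1 hdisj) hxA hxB
    have hBss : B ⊂ M.E := by
      refine hB.ssubset_of_ne ?_
      intro hBE
      obtain ⟨x, hxA⟩ := hAne
      have hxB : x ∈ B := hBE ▸ hA hxA
      exact (Set.disjoint_left.1 hdisj) hxA hxB
    have hltA : A.ncard < n := by
      rw [← hn]
      exact ncard_lt_ncard hAss hEfin
    have hltB : B.ncard < n := by
      rw [← hn]
      exact ncard_lt_ncard hBss hEfin
    have ihA := ih _ hltA (M ↾ A) rfl (hM.restrict hA) _ hνA'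
    have ihB := ih _ hltB (M ↾ B) rfl (hM.restrict hB) _ hνB'
    rw [← hr, ← hEfin.cast_ncard_eq] at hν
    have hE : M.E.ncard = r + ν := by exact_mod_cast hν
    have hsum := nullity_add_le_of_union M hAB hdisj hrA.symm hrB.symm hr.symm hνA hνB hE
    have h1 := KK.P_superadd νA νB
    have h2 := KK.P_mono hsum
    rw [ncard_triangles_eq_add_of_split M hAB hdisj hsplit]
    omega
  obtain ⟨K, hK, hg⟩ := hGB M hM hT hsp ν hν
  have hHE : M.E \ K ⊆ M.E := sdiff_subset
  have hKE : K ⊆ M.E := hK.subset_ground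
  have hHfin : (M.E \ K).Finite := hEfin.subset hHE
  have hKfin : K.Finite := hEfin.subset hKE
  haveI : (M ↾ (M.E \ K)).Finite := Matroid.restrict_finite hHfin
  have hrk := eRk_compl_add_one_eq_eRank M hK
  have hrne : M.eRk (M.E \ K) ≠ ⊤ := ((M.eRk_le_encard _).trans_lt hHfin.encard_lt_top).ne
  obtain ⟨rH, hrH⟩ := ENat.ne_top_iff_exists.1 hrne
  have hEcard : M.E.encard = (M.E \ K).encard + K.encard := by
    rw [← encard_union_eq disjoint_sdiff_left, sdiff_union_of_subset hKE]
  have hrHle : M.eRk (M.E \ K) ≤ (M.E \ K).encard := M.eRk_le_encard _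
  rw [← hr, ← hrH] at hrk
  rw [← hr, hEcard, ← hHfin.cast_ncard_eq, ← hKfin.cast_ncard_eq] at hν
  rw [← hrH, ← hHfin.cast_ncard_eq] at hrHle
  have hrk' : rH + 1 = r := by exact_mod_cast hrk
  have hν' : (M.E \ K).ncard + K.ncard = r + ν := by exact_mod_cast hν
  have hrHle' : rH ≤ (M.E \ K).ncard := by exact_mod_cast hrHle
  have hd1 : 1 ≤ K.ncard := (ncard_pos hKfin).2 hK.nonempty
  have hν2 : (M ↾ (M.E \ K)).E.encard = (M ↾ (M.E \ K)).eRank + ((ν - (K.ncard - 1) : ℕ) : ℕ∞) := by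
    rw [Matroid.restrict_ground_eq, Matroid.eRank_restrict, ← hrH, ← hHfin.cast_ncard_eq]
    have : (M.E \ K).ncard = rH + (ν - (K.ncard - 1)) := by omega
    rw [this]
    push_cast
    rfl
  have hlt : (M.E \ K).ncard < n := by
    rw [← hn]
    exact ncard_lt_ncard (hKE.sdiff_ssubset_of_nonempty hK.nonempty) hEfin
  have ih' := ih _ hlt (M ↾ (M.E \ K)) rfl (hM.restrict hHE) _ hν2
  rw [ncard_triangles_eq_restrict_add_gain M K]
  have hmono : KK.P (ν - (K.ncard - 1)) ≤ KK.P ν := KK.P_mono (Nat.sub_le _ _)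
  omega

end Cocirc

end TriangleCap

end PercRepro
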